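import Mathlib.Analysis.Calculus.ParametricIntegral
import Mathlib.Analysis.Complex.Liouville
import Mathlib.Analysis.Calculus.Deriv.Slope
import HarnessLib

/-!
# Holomorphic dependence of integrals on a complex parameter

A standard lemma used throughout Cohn–Kumar–Miller–Radchenko–Viazovska, arXiv:1902.05438, §5.1
("these estimates prove that `τ ↦ F(τ,r)` is a holomorphic function"): if `K(w,t)` is holomorphic
in `w ∈ U` for a.e. `t`, measurable in `t`, and UNIFORMLY dominated, `‖K(w,t)‖ ≤ B(t)` with `B`
integrable, then `w ↦ ∫ K(w,t) dμ(t)` is holomorphic on `U`. The derivative bound needed for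
differentiation under the integral sign comes from the Cauchy estimate `‖∂_w K(w,t)‖ ≤ B(t)/r` on
discs `B̄(w,r) ⊆ U`.

PROVED here: `differentiableOn_integral_of_dominated_holomorphic`.

## References

* H. Cohn, A. Kumar, S. D. Miller, D. Radchenko, M. Viazovska, Ann. of Math. 196 (2022),
  arXiv:1902.05438, §5.1. [CohnEtAl2019]
-/

noncomputable section

open Filter Topology MeasureTheory Metric Set

namespace Literature.Analysis.Fourier

/-- **Holomorphic parametric integrals.** If `K w ·` is a.e.-strongly measurable for every `w ∈ U`,
`K · t` is holomorphic on the open set `U` for a.e. `t`, and `‖K w t‖ ≤ B t` for all `w ∈ U` and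
a.e. `t` with `B` integrable, then `w ↦ ∫ K w t ∂μ` is holomorphic on `U`. [folklore] -/
theorem differentiableOn_integral_of_dominated_holomorphic {U : Set ℂ} (hU : IsOpen U)
    {μ : Measure ℝ} {K : ℂ → ℝ → ℂ} {B : ℝ → ℝ}
    (hmeas : ∀ w ∈ U, AEStronglyMeasurable (K w) μ)
    (hdiff : ∀ᵐ t ∂μ, DifferentiableOn ℂ (fun w => K w t) U)
    (hbound : ∀ᵐ t ∂μ, ∀ w ∈ U, ‖K w t‖ ≤ B t) (hB : Integrable B μ) :
    DifferentiableOn ℂ (fun w => ∫ t, K w t ∂μ) U := by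
  intro w₀ hw₀
  -- a disc `closedBall w₀ (2r) ⊆ U`
  obtain ⟨R, hR, hRU⟩ := Metric.isOpen_iff.1 hU w₀ hw₀
  set r : ℝ := R / 3 with hr
  have hr0 : 0 < r := by positivity
  have hball : ∀ w ∈ ball w₀ r, closedBall w r ⊆ U := by
    intro w hw z hz
    apply hRU
    rw [mem_ball] at hw ⊢
    rw [mem_closedBall] at hz
    calc dist z w₀ ≤ dist z w + dist w w₀ := dist_triangle _ _ _
      _ < r + r := add_lt_add_of_le_of_lt hz hw
      _ ≤ R := by rw [hr]; linarith
  have hsub : ball w₀ r ⊆ U := fun w hw => hball w hw (mem_closedBall_self hr0.le)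
  -- the derivative and its Cauchy bound
  set K' : ℂ → ℝ → ℂ := fun w t => deriv (fun w => K w t) w
  have hderiv_bound : ∀ᵐ t ∂μ, ∀ w ∈ ball w₀ r, ‖K' w t‖ ≤ B t / r := by
    filter_upwards [hdiff, hbound] with t ht hb w hw
    refine Complex.norm_deriv_le_of_forall_mem_sphere_norm_le hr0 (ht.diffContOnCl_ball (hball w hw)) ?_
    intro z hz
    exact hb z (hball w hw (sphere_subset_closedBall hz))
  have hderiv : ∀ᵐ t ∂μ, ∀ w ∈ ball w₀ r, HasDerivAt (fun w => K w t) (K' w t) w := by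
    filter_upwards [hdiff] with t ht w hw
    exact (ht.differentiableAt (hU.mem_nhds (hsub hw))).hasDerivAt
  -- integrability of `K w₀`
  have hint : Integrable (K w₀) μ :=
    Integrable.mono' hB (hmeas w₀ hw₀) (hbound.mono fun t ht => ht w₀ hw₀)
  -- measurability of `K' w₀` as a limit of difference quotients
  have hK'meas : AEStronglyMeasurable (K' w₀) μ := by
    set δ : ℕ → ℝ := fun n => r / (n + 2) with hδ
    have hδpos : ∀ n, 0 < δ n := fun n => by rw [hδ]; positivity
    have hδlt : ∀ n, δ n < r := fun n => by
      rw [hδ]; dsimp only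
      rw [div_lt_iff₀ (by positivity)]
      nlinarith
    have hδ0 : Tendsto δ atTop (𝓝 0) := by
      have : Tendsto (fun n : ℕ => r / ((n : ℝ) + 2)) atTop (𝓝 0) :=
        tendsto_const_nhds.div_atTop (tendsto_natCast_atTop_atTop.atTop_add tendsto_const_nhds)
      exact this
    have hδne : Tendsto (fun n => ((δ n : ℝ) : ℂ)) atTop (𝓝[≠] 0) := by
      refine tendsto_nhdsWithin_iff.2 ⟨?_, Eventually.of_forall fun n => ?_⟩
      · have h := (Complex.continuous_ofReal.tendsto 0).comp hδ0
        rw [Complex.ofReal_zero] at h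
        exact h
      · simpa using (hδpos n).ne'
    have hmem : ∀ n, w₀ + (δ n : ℂ) ∈ U := fun n => hsub (by
      rw [mem_ball, dist_eq_norm, add_sub_cancel_left, Complex.norm_real, Real.norm_eq_abs, abs_of_pos (hδpos n)]
      exact hδlt n)
    have hseq : ∀ n, AEStronglyMeasurable (fun t => ((δ n : ℝ) : ℂ)⁻¹ • (K (w₀ + δ n) t - K w₀ t)) μ := fun n =>
      (AEStronglyMeasurable.const_smul ((hmeas _ (hmem n)).sub (hmeas w₀ hw₀)) (((δ n : ℝ) : ℂ)⁻¹) :)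
    refine aestronglyMeasurable_of_tendsto_ae atTop hseq ?_
    filter_upwards [hderiv] with t ht
    have h := (ht w₀ (mem_ball_self hr0)).tendsto_slope_zero
    exact h.comp hδne
  -- differentiate under the integral sign
  have key := hasDerivAt_integral_of_dominated_loc_of_deriv_le (μ := μ) (F := K) (F' := K') (x₀ := w₀)
    (bound := fun t => B t / r) (ball_mem_nhds w₀ hr0)
    (Filter.eventually_of_mem (hU.mem_nhds hw₀) fun w hw => hmeas w hw) hint hK'meas
    hderiv_bound (hB.div_const r) hderiv
  exact key.2.differentiableAt.differentiableWithinAt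

end Literature.Analysis.Fourier
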